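import Mathlib
import Summits.Ventures.HodgeRepro2.A1GaloisDescentSubspace

/-!
# Galois permutation of the eigenlines of a base-changed `F`-module

Blind cell `pub-hodge-repro2`, seat p7 (gen 10), A1 annex (route/T4-A1-p7.md, Lemma A1.3's first
sentence; route/LEAN-ANNEX-p7.md §4, third correction, clause (i)).

Setting: `K ⊆ L` fields, `F` a commutative `K`-algebra (the CM field), `V` a `K`-vector space with
a compatible `F`-module structure (`[Module F V] [IsScalarTower K F V]`; in A1, `V = H¹(B, ℚ)` with
its `F`-action).  On the base change `L ⊗[K] V` every `x : F` acts `L`-linearly through the RIGHT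
factor (`actF x`, the base change of `v ↦ x • v`), and for a `K`-embedding `σ : F →ₐ[K] L` the
`σ`-eigenline is the joint eigenspace `eigenline σ = {m | ∀ x, actF x m = σ x • m}` — the abstract
form of the `V_σ` of Lemma A1.3 (`H¹(B, ℚ) ⊗ L = ⊕_σ V_σ`).  The Galois group acts on the LEFT
factor (`act τ = τ ⊗ id`, `τ`-semilinear; `A1GaloisDescentSubspace.act`).

This file records the one-line fact the annex had left in prose: `act τ` commutes with every
`actF x`, hence maps `eigenline σ` ONTO `eigenline (τ ∘ σ)` — the Galois action permutes the
eigenlines through its action on the embeddings (`act_mem_eigenline`, `map_act_eigenline_eq`).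
Nothing here needs finiteness or separability; the decomposition `L ⊗[K] V = ⊕_σ eigenline σ`
itself is a separate statement (the splitting of `L ⊗[K] F`).

What stays prose (A1 §4): the identification of `H¹(B, ℚ) ⊗ L` with such a module (geometry).

README §8(d): uses an L-value-free non-vanishing device: NO.
-/

namespace Summit.Ventures.HodgeRepro2.A1EigenlinePermutation

open TensorProduct
open Summit.Ventures.HodgeRepro2.A1GaloisDescentSubspace

variable {K L : Type*} [Field K] [Field L] [Algebra K L]
variable {F : Type*} [CommRing F] [Algebra K F]
variable {V : Type*} [AddCommGroup V] [Module K V] [Module F V] [IsScalarTower K F V]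

/-- The action of `x : F` on `L ⊗[K] V` through the right factor: the base change to `L` of the
`K`-linear map `v ↦ x • v`.  It is `L`-linear. -/
noncomputable def actF (L : Type*) [Field L] [Algebra K L] (x : F) :
    L ⊗[K] V →ₗ[L] L ⊗[K] V :=
  ((LinearMap.lsmul F V x).restrictScalars K).baseChange L

/-- `actF x` on a pure tensor: `c ⊗ v ↦ c ⊗ (x • v)`. -/
@[simp] theorem actF_tmul (x : F) (c : L) (v : V) :
    actF L x (c ⊗ₜ[K] v) = c ⊗ₜ[K] (x • v) := by
  simp [actF]

/-- `act τ = τ ⊗ id` commutes with `actF x = id ⊗ (x • ·)`. -/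
theorem act_actF (τ : L ≃ₐ[K] L) (x : F) (m : L ⊗[K] V) :
    act τ (actF L x m) = actF L x (act τ m) := by
  induction m using TensorProduct.induction_on with
  | zero => simp
  | tmul c v => simp [act]
  | add a b ha hb => simp only [map_add, ha, hb]

/-- The `σ`-eigenline of `L ⊗[K] V` for a `K`-embedding `σ : F →ₐ[K] L`: the joint eigenspace of
the operators `actF x` for the eigenvalues `σ x` (the `V_σ` of Lemma A1.3). -/
noncomputable def eigenline (L : Type*) [Field L] [Algebra K L] (V : Type*) [AddCommGroup V]
    [Module K V] [Module F V] [IsScalarTower K F V] (σ : F →ₐ[K] L) : Submodule L (L ⊗[K] V) :=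
  ⨅ x : F, Module.End.eigenspace (actF L x) (σ x)

/-- Membership in the `σ`-eigenline: `actF x m = σ x • m` for every `x : F`. -/
theorem mem_eigenline_iff (σ : F →ₐ[K] L) (m : L ⊗[K] V) :
    m ∈ eigenline L V σ ↔ ∀ x : F, actF L x m = σ x • m := by
  simp [eigenline, Submodule.mem_iInf]

/-- `1 ⊗ v` lies in the `σ`-eigenline iff `1 ⊗ (x • v) = σ x • (1 ⊗ v)` for all `x`. -/
theorem one_tmul_mem_eigenline_iff (σ : F →ₐ[K] L) (v : V) :
    (1 : L) ⊗ₜ[K] v ∈ eigenline L V σ ↔ ∀ x : F, (1 : L) ⊗ₜ[K] (x • v) = σ x • ((1 : L) ⊗ₜ[K] v) := by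
  simp [mem_eigenline_iff]

/-- **Galois permutation of the eigenlines.** `act τ` maps the `σ`-eigenline into the
`τ ∘ σ`-eigenline. -/
theorem act_mem_eigenline (τ : L ≃ₐ[K] L) (σ : F →ₐ[K] L) {m : L ⊗[K] V}
    (hm : m ∈ eigenline L V σ) :
    act τ m ∈ eigenline L V ((τ : L →ₐ[K] L).comp σ) := by
  rw [mem_eigenline_iff] at hm ⊢
  intro x
  rw [← act_actF, hm x, act_smul]
  rfl

/-- `τ⁻¹ ∘ (τ ∘ σ) = σ` for the embeddings. -/
theorem inv_comp_comp (τ : L ≃ₐ[K] L) (σ : F →ₐ[K] L) :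
    ((τ⁻¹ : L ≃ₐ[K] L) : L →ₐ[K] L).comp ((τ : L →ₐ[K] L).comp σ) = σ := by
  ext x
  simp

/-- The inverse direction: if `act τ m` lies in the `τ ∘ σ`-eigenline then `m` lies in the
`σ`-eigenline. -/
theorem mem_eigenline_of_act_mem (τ : L ≃ₐ[K] L) (σ : F →ₐ[K] L) {m : L ⊗[K] V}
    (hm : act τ m ∈ eigenline L V ((τ : L →ₐ[K] L).comp σ)) : m ∈ eigenline L V σ := by
  have h := act_mem_eigenline τ⁻¹ _ hm
  rwa [act_act, inv_mul_cancel, act_one, inv_comp_comp] at h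

/-- `act τ m ∈ eigenline (τ ∘ σ) ↔ m ∈ eigenline σ`. -/
theorem act_mem_eigenline_iff (τ : L ≃ₐ[K] L) (σ : F →ₐ[K] L) (m : L ⊗[K] V) :
    act τ m ∈ eigenline L V ((τ : L →ₐ[K] L).comp σ) ↔ m ∈ eigenline L V σ :=
  ⟨mem_eigenline_of_act_mem τ σ, act_mem_eigenline τ σ⟩

/-- **The eigenlines are permuted.** The image of the `σ`-eigenline under `act τ` (a `K`-linear
map; the eigenlines are read as `K`-subspaces) is exactly the `τ ∘ σ`-eigenline. -/
theorem map_act_eigenline_eq (τ : L ≃ₐ[K] L) (σ : F →ₐ[K] L) :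
    ((eigenline L V σ).restrictScalars K).map (act τ) =
      (eigenline L V ((τ : L →ₐ[K] L).comp σ)).restrictScalars K := by
  apply le_antisymm
  · rintro _ ⟨m, hm, rfl⟩
    exact act_mem_eigenline τ σ hm
  · intro m hm
    refine ⟨act τ⁻¹ m, ?_, by rw [act_act, mul_inv_cancel, act_one]⟩
    show act τ⁻¹ m ∈ eigenline L V σ
    exact mem_eigenline_of_act_mem τ σ (by rwa [act_act, mul_inv_cancel, act_one])

/-- The eigenline of a composite `τ ∘ σ` is the `act τ`-image of the eigenline of `σ`
(the same statement read from the target). -/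
theorem eigenline_comp_eq_map (τ : L ≃ₐ[K] L) (σ : F →ₐ[K] L) :
    (eigenline L V ((τ : L →ₐ[K] L).comp σ)).restrictScalars K =
      ((eigenline L V σ).restrictScalars K).map (act τ) :=
  (map_act_eigenline_eq τ σ).symm

end Summit.Ventures.HodgeRepro2.A1EigenlinePermutation
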